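import Mathlib.MeasureTheory.Constructions.HaarToSphere
import Mathlib.MeasureTheory.Integral.Bochner.Basic
import Mathlib.MeasureTheory.Measure.Haar.InnerProductSpace
import Mathlib.MeasureTheory.Measure.Lebesgue.VolumeOfBalls
import Mathlib.Analysis.InnerProductSpace.PiL2
import Literature.Analysis.FluidPDE.ClassicalSolution
import HarnessLib

/-!
# The normalised (Riesz-transform) pressure and Tao's pressure-normalisation lemma

Trunk `Literature/Analysis/FluidPDE`; definition request `defn-NormalisedPressure` (its first
proposal p3765 was bounced on review; this file follows the reviewer's fixes 1–3) and fact item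
`wi-04750` (route NavierStokesRegularity/Blowup: X5b stmt-0153, stmt-0722/0723).

## The object

For a velocity slice `u : ℝᵈ → ℝᵈ` the **normalised pressure** is
`p̃ := -Δ⁻¹ ∂ᵢ∂ⱼ(uᵢ uⱼ) = -Σᵢⱼ RᵢRⱼ(uᵢuⱼ)` (Tao 2011 = arXiv:1108.1165, (35) p. 24 and (42) p. 25,
homogeneous case `f = 0`; the `ℝ³` normalisation is the one of the p. 5 remark after (9), (9)
itself being printed for periodic data). We realise `Δ⁻¹∂ᵢ∂ⱼ` by the classical singular-integral
formula: with `Γ(z) = |z|^{2-d}/((2-d) ω_d)` the Newtonian kernel (`ΔΓ = δ`, `ω_d = |S^{d-1}|`),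
`∂ᵢ∂ⱼΓ(z) = (δᵢⱼ|z|² - d zᵢzⱼ)/(ω_d |z|^{d+2})` and
`∂ᵢ∂ⱼ(Γ * h)(x) = p.v.∫ ∂ᵢ∂ⱼΓ(x-y) h(y) dy + δᵢⱼ h(x)/d` (Gilbarg–Trudinger, Lemma 4.2 with
`Ω₀` a ball: the boundary term is `+δᵢⱼ f(x)/n`), whence, contracting with `uᵢuⱼ`,

  `p̃(x) = -|u(x)|²/d + p.v. ∫ K(x - y)(u(y)) dy`,
  `K(z)(v) := -Σᵢⱼ ∂ᵢ∂ⱼΓ(z) vᵢvⱼ = (d ⟨z,v⟩² - |v|²|z|²)/(ω_d |z|^{d+2})`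

(Fourier side: symbol of `-Δ⁻¹∂ᵢ∂ⱼ` is `ξᵢξⱼ/|ξ|²`; Stein, *Singular integrals* (1970), III §1,
for the p.v. representation of `RᵢRⱼ`). For `u ∈ C^∞ ∩ L²` (the slices of the finite-energy
smooth solutions of the consumers) `uᵢuⱼ ∈ L¹ ∩ C^∞`, the truncated integrals exist (kernel
`O(|z|^{-d})`, integrable against `L¹` away from `x`; smooth `h` and mean-zero kernel near `x`)
and converge, and the formula is Tao's `p̃` pointwise.

## Definitions (namespace `Literature.NS`)

* `unitSphereArea E = ω_d := (volume : Measure E).toSphere.real univ` (Mathlib's surface measure of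
  the unit sphere; `= d · vol(B₁)`, `unitSphereArea_eq`; `ω₃ = 4π`, `unitSphereArea_fin3`).
* `pressureKernel z v = K(z)(v)` (`pressureKernel_eq_fin3`: `(3⟨z,v⟩² - |v|²|z|²)/(4π|z|⁵)` on `ℝ³`);
  `truncatedPressureIntegral u x ε = ∫_{|x-y| > ε} K(x-y)(u y) dy`.
* `HasPressurePV u x L`: the truncated integrands are integrable for all small `ε > 0` AND the
  truncated integrals tend to `L` as `ε → 0⁺` (reviewer fix 1: without the integrability
  conjunct a non-decaying `u` would give the spurious value `0` via `integral_undef`).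
* `normalisedPressure u x := -‖u x‖²/d + L` if `HasPressurePV u x L` for some (unique) `L`, and the
  documented junk value `0` otherwise (off the admissible class); 2-homogeneous in `u`
  (`normalisedPressure_smul`, proved for all `u`, used in the viscosity rescaling below).
* `HasNormalisedPressure u p S`: for every `t ∈ S`, `p t = p̃[u t] + c(t)` for some constant
  `c(t)` — the per-time form of Tao's conclusion (40) (weaker than (40), which has `C` bounded
  measurable; the fact below carries the printed form and the per-time form is a corollary).

## The fact (nothing asserted; users take `(h : tao_pressure_normalisation)`)

* `tao_pressure_normalisation` — Tao 2011, **Lemma 4.1 (i)** (p. 24–25): for an almost smooth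
  finite energy solution, for a.e. `t ∈ [0,T]`, `p(t,x) = -Δ⁻¹∂ᵢ∂ⱼ(uᵢuⱼ)(t,x) + C(t)` with
  `C : [0,T] → ℝ` bounded measurable (homogeneous case `f = 0`). Rendered on `ℝ³` for the tree's
  jointly-smooth class `Fluid.IsClassicalNSSolutionOn (Icc 0 T) ν 0 u p` (Tao-smooth ⊂ almost
  smooth, §1 before Conj. 1.13) with finite energy `sup_{t∈[0,T]} ∫|u(t)|² < ∞` (Tao (6)); general `ν > 0` from
  Tao's `ν = 1` by `v(s,x) = ν⁻¹u(s/ν,x)`, `q = ν⁻²p(s/ν,x)` (a `ν = 1` solution on `[0, νT]`;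
  `p̃` is quadratic in `u` and the pressure Poisson equation `Δp = -∂ᵢ∂ⱼ(uᵢuⱼ)` does not see `ν`).
* `tao_pressure_normalisation.ae_hasNormalisedPressure` — PROVED corollary: the per-time form.

## Mathlib search

`toSphere`, `Measure.toSphere_real_apply_univ` (surface area — used, reviewer fix 2; the tree's
`Literature.MathematicalPhysics.KineticTheory.sphereMeasure` is the same measure), `EuclideanSpace.volume_ball_fin_three` (used), `rieszTransform`/`Riesz` (nothing),
`singularIntegral` (nothing), `fundamentalSolution`/Newtonian kernel (nothing usable),
`Metric.closedBall`, `nhdsWithin`/`𝓝[>]`, `MeasureTheory.IntegrableOn` (used).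

## References

* T. Tao, *Localisation and compactness properties of the Navier–Stokes global regularity
  problem*, Anal. PDE 6 (2013) = arXiv:1108.1165: (8), (9) p. 5; (35) p. 24; Lemma 4.1, (40),
  (42), Remark 4.2, Cor. 4.3, pp. 24–28.
* D. Gilbarg, N. Trudinger, *Elliptic PDE of second order*, (2.12), Lemma 4.2, (4.9)–(4.10).
* E. M. Stein, *Singular integrals and differentiability properties of functions* (1970), III §1.
-/

noncomputable section

open MeasureTheory Set Filter Metric Topology
open scoped ENNReal RealInnerProductSpace ContDiff

namespace Literature.Analysis.FluidPDE

section Kernel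

variable (E : Type*) [NormedAddCommGroup E] [InnerProductSpace ℝ E] [FiniteDimensional ℝ E]
  [MeasurableSpace E] [BorelSpace E]

/-- `ω_d = |S^{d-1}|`, the surface area of the unit sphere of `E` (`d = dim E`): the total mass of
Mathlib's surface measure `volume.toSphere` on the unit sphere (`= d · vol(B₁)`; `4π` for
`d = 3`). [Gilbarg–Trudinger, (2.12) notation `n ωₙ`] [folklore] -/
def unitSphereArea : ℝ :=
  (volume : Measure E).toSphere.real univ

/-- `ω_d = d · vol(B₁)` (Mathlib `Measure.toSphere_real_apply_univ`). [folklore] -/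
theorem unitSphereArea_eq :
    unitSphereArea E = Module.finrank ℝ E * (volume : Measure E).real (ball 0 1) :=
  Measure.toSphere_real_apply_univ _

/-- `ω₃ = |S²| = 4π` (from Mathlib `EuclideanSpace.volume_ball_fin_three`, `vol(B₁) = 4π/3`).
[Gilbarg–Trudinger, (2.12)] [folklore] -/
theorem unitSphereArea_fin3 : unitSphereArea (EuclideanSpace ℝ (Fin 3)) = 4 * Real.pi := by
  rw [unitSphereArea_eq, finrank_euclideanSpace_fin, Measure.real,
    EuclideanSpace.volume_ball_fin_three]
  rw [ENNReal.toReal_mul, ENNReal.ofReal_one, one_pow, ENNReal.toReal_one,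
    ENNReal.toReal_ofReal (by positivity)]
  ring

variable {E}

/-- **The pressure kernel** `K(z)(v) = -Σᵢⱼ ∂ᵢ∂ⱼΓ(z) vᵢ vⱼ = (d ⟨z, v⟩² - |v|² |z|²)/(ω_d |z|^{d+2})`,
`Γ` the Newtonian kernel with `ΔΓ = δ` (`∂ᵢ∂ⱼΓ(z) = (δᵢⱼ|z|² - d zᵢ zⱼ)/(ω_d|z|^{d+2})`), so that
`-Δ⁻¹∂ᵢ∂ⱼ(uᵢuⱼ)(x) = -|u(x)|²/d + p.v.∫ K(x-y)(u(y)) dy`. Value `0` at `z = 0` (Lean `x/0 = 0`;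
the diagonal is excised by the truncation anyway). [Gilbarg–Trudinger, (2.12) and (4.9)–(4.10);
Tao 2011, (35)] [folklore] -/
def pressureKernel (z v : E) : ℝ :=
  (Module.finrank ℝ E * ⟪z, v⟫ ^ 2 - ‖v‖ ^ 2 * ‖z‖ ^ 2) /
    (unitSphereArea E * ‖z‖ ^ (Module.finrank ℝ E + 2))

/-- `K(0)(v) = 0` (junk value on the diagonal). [folklore] -/
@[simp] theorem pressureKernel_zero_left (v : E) : pressureKernel (0 : E) v = 0 := by
  simp [pressureKernel]

/-- `K(z)(0) = 0`. [folklore] -/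
@[simp] theorem pressureKernel_zero_right (z : E) : pressureKernel z (0 : E) = 0 := by
  simp [pressureKernel]

/-- The kernel is quadratic in the velocity slot: `K(z)(c v) = c² K(z)(v)`. [folklore] -/
theorem pressureKernel_smul_right (z v : E) (c : ℝ) :
    pressureKernel z (c • v) = c ^ 2 * pressureKernel z v := by
  simp only [pressureKernel, inner_smul_right, norm_smul, Real.norm_eq_abs, mul_pow, sq_abs]
  ring

/-- On `ℝ³`: `K(z)(v) = (3⟨z,v⟩² - |v|²|z|²)/(4π|z|⁵)` (Tao 2011, (35): the kernel of
`-Δ⁻¹∂ᵢ∂ⱼ` contracted with `vᵢvⱼ`). [folklore] -/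
theorem pressureKernel_eq_fin3 (z v : EuclideanSpace ℝ (Fin 3)) :
    pressureKernel z v = (3 * ⟪z, v⟫ ^ 2 - ‖v‖ ^ 2 * ‖z‖ ^ 2) / (4 * Real.pi * ‖z‖ ^ 5) := by
  rw [pressureKernel, unitSphereArea_fin3, finrank_euclideanSpace_fin]
  norm_num

/-- The **truncated singular integral** `∫_{|x - y| > ε} K(x - y)(u(y)) dy` (Bochner integral over
the complement of the closed `ε`-ball; junk `0` if not integrable). [Stein 1970, III §1
(truncated Riesz transforms); Gilbarg–Trudinger, Lemma 4.2] [folklore] -/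
def truncatedPressureIntegral (u : E → E) (x : E) (ε : ℝ) : ℝ :=
  ∫ y in (closedBall x ε)ᶜ, pressureKernel (x - y) (u y)

/-- **Principal value.** `HasPressurePV u x L`: for all sufficiently small `ε > 0` the truncated
integrand `y ↦ K(x-y)(u y)` is integrable on `{|x-y| > ε}`, and the truncated integrals converge
to `L` as `ε → 0⁺` (`L = p.v.∫ K(x-y)(u(y)) dy`). The integrability conjunct rules out the
spurious value produced by `integral_undef` for non-decaying `u`. Holds (with the classical
value) for `u ∈ C^∞ ∩ L²`. [Stein 1970, III §1; Tao 2011, (35)/(42)] [folklore] -/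
def HasPressurePV (u : E → E) (x : E) (L : ℝ) : Prop :=
  (∀ᶠ ε in 𝓝[>] (0 : ℝ), IntegrableOn (fun y ↦ pressureKernel (x - y) (u y)) (closedBall x ε)ᶜ) ∧
    Tendsto (truncatedPressureIntegral u x) (𝓝[>] 0) (𝓝 L)

/-- The principal value is unique. [folklore] -/
theorem HasPressurePV.unique {u : E → E} {x : E} {L₁ L₂ : ℝ} (h₁ : HasPressurePV u x L₁)
    (h₂ : HasPressurePV u x L₂) : L₁ = L₂ :=
  tendsto_nhds_unique h₁.2 h₂.2

/-- The truncated integrals of the zero field vanish. [folklore] -/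
@[simp] theorem truncatedPressureIntegral_zero (x : E) (ε : ℝ) :
    truncatedPressureIntegral (0 : E → E) x ε = 0 := by
  simp [truncatedPressureIntegral]

/-- The zero field has principal value `0` everywhere. [folklore] -/
theorem hasPressurePV_zero (x : E) : HasPressurePV (0 : E → E) x 0 := by
  refine ⟨Eventually.of_forall fun ε ↦ ?_, ?_⟩
  · simp
  · have : truncatedPressureIntegral (0 : E → E) x = fun _ ↦ 0 := by
      funext ε; simp
    rw [this]
    exact tendsto_const_nhds

open Classical in
/-- **The normalised (Riesz-transform) pressure** `p̃[u](x) = -Δ⁻¹∂ᵢ∂ⱼ(uᵢuⱼ)(x)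
= -|u(x)|²/d + p.v.∫ K(x-y)(u(y)) dy` of a velocity slice `u : E → E` (Tao 2011, (35), (42) with
`f = 0`), realised by the singular integral; documented junk value `0` at points where the
principal value does not exist (never on the admissible class `u ∈ C^∞ ∩ L²`).
[Tao 2011, (35) p. 24 and (42) p. 25; Gilbarg–Trudinger, Lemma 4.2] [cite: Tao2011, (35) and (42)] -/
def normalisedPressure (u : E → E) (x : E) : ℝ :=
  if h : ∃ L, HasPressurePV u x L then -‖u x‖ ^ 2 / Module.finrank ℝ E + h.choose else 0

/-- On the admissible locus, `p̃[u](x) = -|u(x)|²/d + p.v.∫ K(x-y)(u(y)) dy`. [Tao 2011, (35)] [folklore] -/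
theorem normalisedPressure_eq {u : E → E} {x : E} {L : ℝ} (h : HasPressurePV u x L) :
    normalisedPressure u x = -‖u x‖ ^ 2 / Module.finrank ℝ E + L := by
  have hex : ∃ L, HasPressurePV u x L := ⟨L, h⟩
  rw [normalisedPressure, dif_pos hex, hex.choose_spec.unique h]

/-- Off the admissible locus the value is the junk `0`. [folklore] -/
theorem normalisedPressure_eq_zero_of_not_exists {u : E → E} {x : E}
    (h : ¬ ∃ L, HasPressurePV u x L) : normalisedPressure u x = 0 := by
  rw [normalisedPressure, dif_neg h]

/-- `p̃[0] = 0`. [folklore] -/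
@[simp] theorem normalisedPressure_zero : normalisedPressure (0 : E → E) = 0 := by
  funext x
  rw [normalisedPressure_eq (hasPressurePV_zero x)]
  simp

/-- The truncated integrals are quadratic in `u`. [folklore] -/
theorem truncatedPressureIntegral_smul (u : E → E) (c : ℝ) (x : E) (ε : ℝ) :
    truncatedPressureIntegral (c • u) x ε = c ^ 2 * truncatedPressureIntegral u x ε := by
  simp only [truncatedPressureIntegral, Pi.smul_apply, pressureKernel_smul_right]
  exact integral_const_mul _ _

/-- Principal values are quadratic in `u`. [folklore] -/
theorem HasPressurePV.smul {u : E → E} {x : E} {L : ℝ} (h : HasPressurePV u x L) (c : ℝ) :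
    HasPressurePV (c • u) x (c ^ 2 * L) := by
  refine ⟨h.1.mono fun ε hε ↦ ?_, ?_⟩
  · simp only [Pi.smul_apply, pressureKernel_smul_right]
    exact hε.const_mul (c ^ 2)
  · have : truncatedPressureIntegral (c • u) x = fun ε ↦ c ^ 2 * truncatedPressureIntegral u x ε :=
      funext (truncatedPressureIntegral_smul u c x)
    rw [this]
    exact h.2.const_mul _

/-- For `c ≠ 0`, `c • u` has a principal value at `x` iff `u` does. [folklore] -/
theorem hasPressurePV_smul_iff {u : E → E} {x : E} {c : ℝ} (hc : c ≠ 0) (L : ℝ) :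
    HasPressurePV (c • u) x L ↔ HasPressurePV u x (c⁻¹ ^ 2 * L) := by
  constructor
  · intro h
    simpa [smul_smul, inv_mul_cancel₀ hc] using h.smul c⁻¹
  · intro h
    have := h.smul c
    rwa [← mul_assoc, ← mul_pow, mul_inv_cancel₀ hc, one_pow, one_mul] at this

/-- **`p̃` is 2-homogeneous**: `p̃[c u] = c² p̃[u]` (used with `c = ν⁻¹` in the viscosity
rescaling of Tao's `ν = 1` statements). [folklore] -/
theorem normalisedPressure_smul (u : E → E) (c : ℝ) (x : E) :
    normalisedPressure (c • u) x = c ^ 2 * normalisedPressure u x := by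
  rcases eq_or_ne c 0 with rfl | hc
  · simp [zero_smul]
  by_cases h : ∃ L, HasPressurePV u x L
  · obtain ⟨L, hL⟩ := h
    rw [normalisedPressure_eq hL, normalisedPressure_eq (hL.smul c), Pi.smul_apply, norm_smul,
      Real.norm_eq_abs, mul_pow, sq_abs]
    ring
  · have h' : ¬ ∃ L, HasPressurePV (c • u) x L := fun ⟨L, hL⟩ ↦
      h ⟨_, (hasPressurePV_smul_iff hc L).1 hL⟩
    rw [normalisedPressure_eq_zero_of_not_exists h, normalisedPressure_eq_zero_of_not_exists h',
      mul_zero]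

/-- **Normalised pressure up to a time-dependent constant** on the time set `S`: for every
`t ∈ S` there is `c(t) ∈ ℝ` with `p(t, x) = p̃[u(t)](x) + c(t)` for all `x` — the per-time form of
Tao's (40) (which in addition has `C` bounded measurable on `[0,T]`). [Tao 2011, Lemma 4.1 (i),
(40)] [cite: Tao2011, Lemma 4.1 (i)] -/
def HasNormalisedPressure (u : ℝ → E → E) (p : ℝ → E → ℝ) (S : Set ℝ) : Prop :=
  ∀ t ∈ S, ∃ c : ℝ, ∀ x, p t x = normalisedPressure (u t) x + c

/-- Monotonicity in the time set. [folklore] -/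
theorem HasNormalisedPressure.mono {u : ℝ → E → E} {p : ℝ → E → ℝ} {S S' : Set ℝ}
    (h : HasNormalisedPressure u p S) (hS : S' ⊆ S) : HasNormalisedPressure u p S' :=
  fun t ht ↦ h t (hS ht)

/-- Invariance under the pressure-shift symmetry `p ↦ p + C(t)` (Tao 2011, (32)). [cite: Tao2011, (32)] -/
theorem HasNormalisedPressure.add_const {u : ℝ → E → E} {p : ℝ → E → ℝ} {S : Set ℝ}
    (h : HasNormalisedPressure u p S) (C : ℝ → ℝ) :
    HasNormalisedPressure u (fun t x ↦ p t x + C t) S := by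
  intro t ht
  obtain ⟨c, hc⟩ := h t ht
  exact ⟨c + C t, fun x ↦ by simp only [hc x]; ring⟩

/-- The normalised pressure itself is normalised (with `c = 0`). [folklore] -/
theorem hasNormalisedPressure_normalisedPressure (u : ℝ → E → E) (S : Set ℝ) :
    HasNormalisedPressure u (fun t ↦ normalisedPressure (u t)) S :=
  fun _ _ ↦ ⟨0, fun _ ↦ by simp⟩

end Kernel

/-! ### Tao's pressure-normalisation lemma (named fact) -/

/-- **Tao 2011, Lemma 4.1 (i) (reduction to normalised pressure), homogeneous case on `ℝ³`.**
Let `ν > 0`, `0 < T`, and let `(u, p)` be a classical solution of the unforced Navier–Stokes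
system jointly smooth on `[0,T] × ℝ³` (`Fluid.IsClassicalNSSolutionOn (Icc 0 T) ν 0 u p`; Tao's
almost smooth class is larger) with finite energy `sup_{t ∈ [0,T]} ∫ |u(t)|² < ∞` (Tao (6)).
Then there is a bounded measurable `C : [0,T] → ℝ` such that for almost every `t ∈ [0,T]`,
`p(t, x) = -Δ⁻¹∂ᵢ∂ⱼ(uᵢuⱼ)(t, x) + C(t)` for all `x` (Tao (40) with `f = 0`; `-Δ⁻¹∂ᵢ∂ⱼ(uᵢuⱼ)` is
`normalisedPressure (u t)`). Printed for `ν = 1`; `ν > 0` by the rescaling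
`(s, x) ↦ (ν⁻¹ u(s/ν, x), ν⁻² p(s/ν, x))`. Nothing asserted. [cite: Tao2011, Lemma 4.1 (i)] -/
def tao_pressure_normalisation : Prop :=
  ∀ (ν T : ℝ), 0 < ν → 0 < T →
    ∀ (u : ℝ → EuclideanSpace ℝ (Fin 3) → EuclideanSpace ℝ (Fin 3))
      (p : ℝ → EuclideanSpace ℝ (Fin 3) → ℝ),
      FluidPDE.IsClassicalNSSolutionOn (Icc 0 T) ν 0 u p →
      (∃ C : ℝ≥0∞, C < ⊤ ∧ ∀ t ∈ Icc 0 T, ∫⁻ x, ‖u t x‖ₑ ^ 2 ≤ C) →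
      ∃ C : ℝ → ℝ, Measurable C ∧ (∃ M : ℝ, ∀ t ∈ Icc 0 T, |C t| ≤ M) ∧
        ∀ᵐ t ∂(volume.restrict (Icc 0 T)), ∀ x, p t x = normalisedPressure (u t) x + C t

/-- Per-time corollary of Lemma 4.1 (i): for a.e. `t ∈ [0,T]` the pressure is the normalised
pressure up to a constant, i.e. `HasNormalisedPressure u p {t}` for a.e. `t` (the form requested
by `defn-NormalisedPressure`). PROVED from the named fact. [cite: Tao2011, Lemma 4.1 (i)] -/
theorem tao_pressure_normalisation.ae_hasNormalisedPressure (h : tao_pressure_normalisation)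
    {ν T : ℝ} (hν : 0 < ν) (hT : 0 < T)
    {u : ℝ → EuclideanSpace ℝ (Fin 3) → EuclideanSpace ℝ (Fin 3)}
    {p : ℝ → EuclideanSpace ℝ (Fin 3) → ℝ}
    (hs : FluidPDE.IsClassicalNSSolutionOn (Icc 0 T) ν 0 u p)
    (hE : ∃ C : ℝ≥0∞, C < ⊤ ∧ ∀ t ∈ Icc 0 T, ∫⁻ x, ‖u t x‖ₑ ^ 2 ≤ C) :
    ∀ᵐ t ∂(volume.restrict (Icc 0 T)), HasNormalisedPressure u p {t} := by
  obtain ⟨C, -, -, hae⟩ := h ν T hν hT u p hs hE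
  filter_upwards [hae] with t ht
  intro s hs'
  obtain rfl : s = t := hs'
  exact ⟨C s, ht⟩

end Literature.Analysis.FluidPDE

end
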